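import Summits.QuantumFields.GaugeBoot.DiagonalRPTorusGaugeInvariantTwo
import HarnessLib

/-!
# Diagonal RP on the two-dimensional even torus, gauge-invariant sector: `L = 4` and `L = 2`
(gauge-boot, task L3(ζ) — completes L3(ε))

HONEST FRAMING (cell `pub-gaugeboot`, page 1 of every file): the venture produces certified bounds
on lattice expectations at stated coupling, gauge group, dimension and torus size; NOT a mass gap,
NOT a continuum limit, NOT a string tension; NOT Yang–Mills-summit-bearing (barriers
`FixedCouplingUltralocality`, `PerturbativeInvisibility`). This module is a small structural
result about which positivity constraints a two-dimensional TORUS certificate may use; it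
discharges nothing else (no 2D certificate with a diagonal block exists or is planned).

`DiagonalRPTorusGaugeInvariantTwo.lean` (L3(ε)) proves `GaugeInvariantDiagonalRP ρ β i j` — closed
half diagonal reflection positivity for GAUGE-INVARIANT observables — on `(ℤ/L)²` for `L ≥ 6`
even and `β ≥ 0`, and leaves `L = 4` open. This module closes the two remaining even sizes:

* **`DiagRPTwo.gaugeInvariantDiagonalRP_two_of_four_le`** — the same statement for EVERY even
  `L ≥ 4` (so `L = 4` HOLDS). In L3(ε) the hypothesis `6 ≤ L` enters at exactly one point,
  `untwist'_apply_of_mem_blk_S0`: the Haar-preserving correction `Ψ₂ = Θ Ψ₁ Θ` fixes the four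
  LINKS of every mirror plaquette. At `L = 4` (`c = 2`, `c + 1 = -1`) it does not: it moves the
  two links of the mirror transport `D_y = U(y,j) U(y+e_j,i)` — but by the rotation gauge `h` at
  their COMMON vertex `y + e_j` (height `-1`; `Ψ₁` is the gauge action of `h⁻¹` on the links off
  the back layer and `h = 1` on the mirror layer), so the PATH `D_y`, hence
  `r_y = Re tr ρ(C_y D_y⁻¹)` and the crossing weight `E`, is `Ψ₂`-invariant for every even
  `L ≥ 4` (`dT_untwist'_of_kd_eq_zero`, `crossE_untwist'_of_four_le`); Step 3 of L3(ε) then goes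
  through verbatim (`integral_twisted_eq_of_four_le`, …).
* **`DiagRPTwo.not_gaugeInvariantDiagonalRP_two_two`** — on the `2 × 2` torus the statement
  FAILS at EVERY real `β`, for every continuous `ρ` with non-constant character, with a
  GAUGE-INVARIANT odd witness: `F = r_{e_i} - r_{e_j}`, the difference of the two plaquette terms
  based on the back layer `k = 1`, which the swap exchanges
  (`exists_gaugeInvariant_wilsonExpectation_neg_two_two`; the `L = 2` witness of
  `DiagonalRPTorusTwoDegenerate.lean` was gauge-variant).
* **`DiagRPTwo.gaugeInvariantDiagonalRP_two_iff`** — the complete `d = 2` classification: for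
  `L ≥ 2` even, `β ≥ 0`, compact metrisable `G`, continuous `ρ` with `∃ g, Re tr ρ g ≠ N`:
  `GaugeInvariantDiagonalRP ρ β i j ↔ 4 ≤ L`.

So on the square even torus the gauge-invariant closed-half diagonal-RP question is settled for
every `L`; the gauge-variant statement holds iff `β = 0` (`L ≥ 4`, L3(δ)); in `d ≥ 3` both fail
(`DiagonalRPTorusNegative.lean`, `DiagonalRPTorusGaugeInvariantNegative.lean`).

References: Osterwalder–Seiler, Ann. Phys. 110 (1978) 440, §2; Seiler, LNP 159 (1982) Ch. 2;
Kazakov–Zheng, arXiv:2203.11360 §3.1. The statements themselves are, as far as we searched, not in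
print.
Printed precedent (nearest-neighbour spin systems, a remark without proof): periodic boundary conditions destroy
diagonal RP — Fröhlich–Israel–Lieb–Simon, J. Stat. Phys. 22 (1980) 297, §3 (Model 3.1); M. Biskup, in LNM 1970
(2009) §5.5; the statements here are theorem-level, gauge-theoretic forms of that obstruction (tribunal t2 F-R1).
-/

open MeasureTheory Complex Finset Function
open scoped ComplexOrder ENNReal

namespace Summit.QuantumFields.GaugeBoot

open Literature.MathematicalPhysics.QuantumFieldTheory
open Literature.RepresentationTheory.CompactGroups

noncomputable section

namespace DiagRPTwo

/-! ## `Ψ₂` fixes the mirror transports for every even `L ≥ 4` -/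

section PsiFour

variable {L : ℕ} {i j : Fin 2} {G : Type*} [Group G]

/-- `Ψ₁` on a link off the back layer is the gauge action of `h⁻¹`. -/
theorem untwist_apply_of_not_tw (X : GaugeConfig 2 L G) {e : Edge 2 L} (he : ¬TW i j e) :
    untwist i j X e = (hfun i j X e.1)⁻¹ * X e * hfun i j X (e.1.shift e.2) := if_neg he

omit [Group G] in
/-- `(ΘX)(e) = X(θe)`. -/
theorem configDiagSwap_apply (X : GaugeConfig 2 L G) (e : Edge 2 L) :
    configDiagSwap i j X e = X (edgeDiagSwap i j e) := rfl

/-- The rotation gauge is trivial on the mirror layer `k = 0` (`L ≥ 4`). -/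
theorem hfun_eq_one_of_kd_eq_zero (h4 : 4 ≤ L) (X : GaugeConfig 2 L G) {y : Site 2 L}
    (hy : kd i j y = 0) : hfun i j X y = 1 :=
  hfun_eq_one X (by rw [hy]; exact fun h => cc_ne_one h4 (sub_eq_zero.1 h.symm))
    (by rw [hy]; exact fun h => cc_ne_zero h4 h.symm)

/-- `Ψ₂` fixes the mirror transport `C_y = U(y,i) U(y+e_i,j)`, `k(y) = 0`, link by link
(`L ≥ 4` even). -/
theorem cT_untwist'_of_kd_eq_zero (hL : Even L) (h4 : 4 ≤ L) (hij : i ≠ j)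
    (X : GaugeConfig 2 L G) {y : Site 2 L} (hk : kd i j y = 0) :
    cT i j (untwist' i j X) y = cT i j X y := by
  have hv := val_cc_add_one (L := L) h4
  have h1v := val_one_of_four_le h4
  have h0c : (0 : ZMod L) ≠ cc L := fun h => cc_ne_zero h4 h.symm
  have h0c1 : (0 : ZMod L) ≠ cc L + 1 := fun h => by
    have := congrArg ZMod.val h; rw [ZMod.val_zero, hv] at this; omega
  have h1c : (1 : ZMod L) ≠ cc L := fun h => cc_ne_one h4 h.symm
  have h1c1 : (1 : ZMod L) ≠ cc L + 1 := fun h => by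
    have := congrArg ZMod.val h; rw [h1v, hv] at this; omega
  have hki : kd i j (y.shift i) = 1 := by rw [kd_shift_left hij, hk, zero_add]
  have hkij : kd i j ((y.shift i).shift j) = 0 := by rw [kd_shift_right hij, hki, sub_self]
  have A : untwist' i j X (y, i) = X (y, i) :=
    untwist'_apply_of_ne hL X (by rw [hk]; exact h0c) (by rw [hk]; exact h0c1)
      (by rw [hki]; exact h1c) (by rw [hki]; exact h1c1)
  have B : untwist' i j X (y.shift i, j) = X (y.shift i, j) :=
    untwist'_apply_of_ne hL X (by rw [hki]; exact h1c) (by rw [hki]; exact h1c1)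
      (by rw [hkij]; exact h0c) (by rw [hkij]; exact h0c1)
  rw [cT, cT, A, B]

/-- **`Ψ₂` fixes the mirror transport `D_y = U(y,j) U(y+e_j,i)`, `k(y) = 0`, for every even
`L ≥ 4`.** For `L ≥ 6` both links are fixed (`untwist'_apply_of_mem_blk_S0`); at `L = 4` they are
moved by the rotation gauge at their common vertex `y + e_j` (height `-1 = c + 1`), which
cancels in the product. The proof below is uniform in `L`. -/
theorem dT_untwist'_of_kd_eq_zero (h4 : 4 ≤ L) (hij : i ≠ j) (X : GaugeConfig 2 L G)
    {y : Site 2 L} (hk : kd i j y = 0) : dT i j (untwist' i j X) y = dT i j X y := by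
  have h0c : (0 : ZMod L) ≠ cc L := fun h => cc_ne_zero h4 h.symm
  have h1c : (1 : ZMod L) ≠ cc L := fun h => cc_ne_one h4 h.symm
  have hz : kd i j (siteDiagSwap i j y) = 0 := by rw [kd_siteDiagSwap, hk, neg_zero]
  have hzi : kd i j ((siteDiagSwap i j y).shift i) = 1 := by rw [kd_shift_left hij, hz, zero_add]
  have hzij : kd i j (((siteDiagSwap i j y).shift i).shift j) = 0 := by
    rw [kd_shift_right hij, hzi, sub_self]
  -- the two swapped links lie between the layers `0` and `1`: off the back layer
  have nt1 : ¬TW i j (siteDiagSwap i j y, i) := by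
    rintro (h | h)
    · exact h0c (hz.symm.trans h)
    · exact h1c (hzi.symm.trans h)
  have nt2 : ¬TW i j ((siteDiagSwap i j y).shift i, j) := by
    rintro (h | h)
    · exact h1c (hzi.symm.trans h)
    · exact h0c (hzij.symm.trans h)
  have e1 : edgeDiagSwap i j (y, j) = (siteDiagSwap i j y, i) := by
    simp only [edgeDiagSwap, Equiv.swap_apply_right]
  have e2 : edgeDiagSwap i j (y.shift j, i) = ((siteDiagSwap i j y).shift i, j) := by
    simp only [edgeDiagSwap, siteDiagSwap_shift, Equiv.swap_apply_right, Equiv.swap_apply_left]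
  have e3 : edgeDiagSwap i j (siteDiagSwap i j y, i) = (y, j) := by
    simp only [edgeDiagSwap, siteDiagSwap_siteDiagSwap, Equiv.swap_apply_left]
  have e4 : edgeDiagSwap i j ((siteDiagSwap i j y).shift i, j) = (y.shift j, i) := by
    simp only [edgeDiagSwap, siteDiagSwap_shift, siteDiagSwap_siteDiagSwap, Equiv.swap_apply_left,
      Equiv.swap_apply_right]
  -- the rotation gauge is `1` at the two mirror-layer endpoints
  have hone1 : hfun i j (configDiagSwap i j X) (siteDiagSwap i j y) = 1 :=
    hfun_eq_one_of_kd_eq_zero h4 _ hz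
  have hone2 : hfun i j (configDiagSwap i j X) (((siteDiagSwap i j y).shift i).shift j) = 1 :=
    hfun_eq_one_of_kd_eq_zero h4 _ hzij
  have A : untwist' i j X (y, j) =
      X (y, j) * hfun i j (configDiagSwap i j X) ((siteDiagSwap i j y).shift i) := by
    show untwist i j (configDiagSwap i j X) (edgeDiagSwap i j (y, j)) = _
    rw [e1, untwist_apply_of_not_tw _ nt1, hone1, inv_one, one_mul, configDiagSwap_apply, e3]
  have B : untwist' i j X (y.shift j, i) =
      (hfun i j (configDiagSwap i j X) ((siteDiagSwap i j y).shift i))⁻¹ * X (y.shift j, i) := by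
    show untwist i j (configDiagSwap i j X) (edgeDiagSwap i j (y.shift j, i)) = _
    rw [e2, untwist_apply_of_not_tw _ nt2, hone2, mul_one, configDiagSwap_apply, e4]
  rw [dT, dT, A, B, mul_assoc, mul_inv_cancel_left]

variable {N : ℕ} (ρ : G →* Matrix (Fin N) (Fin N) ℂ)

/-- `Ψ₂` fixes the mirror plaquette terms `r_y`, `k(y) = 0` (`L ≥ 4` even). -/
theorem rr_untwist'_of_kd_eq_zero (hL : Even L) (h4 : 4 ≤ L) (hij : i ≠ j)
    (X : GaugeConfig 2 L G) {y : Site 2 L} (hk : kd i j y = 0) :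
    rr ρ i j (untwist' i j X) y = rr ρ i j X y := by
  rw [rr, rr, cT_untwist'_of_kd_eq_zero hL h4 hij X hk, dT_untwist'_of_kd_eq_zero h4 hij X hk]

end PsiFour

/-! ## Assembly for every even `L ≥ 4` -/

section MainFour

variable {L N : ℕ} [NeZero L] {G : Type*} [Group G] [TopologicalSpace G] [IsTopologicalGroup G]
  [CompactSpace G] [MeasurableSpace G] [BorelSpace G] [SecondCountableTopology G]
  (ρ : G →* Matrix (Fin N) (Fin N) ℂ)

omit [TopologicalSpace G] [IsTopologicalGroup G] [CompactSpace G] [MeasurableSpace G] [BorelSpace G]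
  [SecondCountableTopology G] in
/-- **`Ψ₂` fixes the crossing weight `E = exp(β(Σ_{k=0} r_y + Σ_{k=c} r_y))` for every even
`L ≥ 4`** (L3(ε)'s `crossE_untwist'` needed `L ≥ 6`). -/
theorem crossE_untwist'_of_four_le (hL : Even L) (h4 : 4 ≤ L) {i j : Fin 2} (hij : i ≠ j)
    (β : ℝ) (U : GaugeConfig 2 L G) : crossE ρ i j β (untwist' i j U) = crossE ρ i j β U := by
  have h0 : ∑ y ∈ S0 i j, rr ρ i j (untwist' i j U) y = ∑ y ∈ S0 i j, rr ρ i j U y :=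
    Finset.sum_congr rfl fun y hy =>
      rr_untwist'_of_kd_eq_zero ρ hL h4 hij U ((kd_eq_zero_iff y).2 (mem_S0.1 hy))
  have hc : ∑ y ∈ Sc i j, rr ρ i j (untwist' i j U) y = ∑ y ∈ Sc i j, rr ρ i j U y :=
    Finset.sum_congr rfl fun y hy => dependsOn_blk i j y (fun c d => ((ρ (c * d⁻¹)).trace).re)
      fun e he => untwist'_apply_of_mem_blk_Sc hL h4 hij U hy (Finset.mem_coe.1 he)
  rw [crossE, crossE, h0, hc]

/-- **Removing the twist**, every even `L ≥ 4`, `β ≥ 0`: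
`∫ g conj(g∘Θ') exp(Σ a conj(a∘Θ')) = ∫ g conj(g∘Θ) E` for gauge-invariant `F`. -/
theorem integral_twisted_eq_of_four_le (hL : Even L) (h4 : 4 ≤ L) {i j : Fin 2} (hij : i ≠ j)
    (hρ : Continuous ρ) {β : ℝ} (hβ : 0 ≤ β) {F : GaugeConfig 2 L G → ℂ} (hF : Measurable F)
    (hFH : IsDiagonalHalfObservable i j F) (hFg : IsGaugeInvariant F) :
    ∫ U, gObs ρ i j β F U * (starRingEnd ℂ) (gObs ρ i j β F (configTwistSwap i j U)) *
        Complex.exp (∑ ι, gcoeff ρ i j hρ β ι U *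
          (starRingEnd ℂ) (gcoeff ρ i j hρ β ι (configTwistSwap i j U))) ∂(linkMeasure L G) =
      ∫ U, rpPhi ρ i j β F U ∂(linkMeasure L G) := by
  have hpt : ∀ U : GaugeConfig 2 L G,
      gObs ρ i j β F U * (starRingEnd ℂ) (gObs ρ i j β F (configTwistSwap i j U)) *
        Complex.exp (∑ ι, gcoeff ρ i j hρ β ι U *
          (starRingEnd ℂ) (gcoeff ρ i j hρ β ι (configTwistSwap i j U))) =
        rpPhi ρ i j β F (untwist' i j U) := by
    intro U
    rw [sum_gcoeff_mul_conj ρ hL h4 hij hρ hβ, ← Complex.ofReal_exp, configTwistSwap_eq,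
      gObs_configTau ρ h4 hij β hFH hFg, rpPhi, crossE_untwist'_of_four_le ρ hL h4 hij β U, crossE,
      configDiagSwap_untwist']
    congr 2
    exact dependsOn_gObs ρ h4 hij β hFH fun e he =>
      (untwist'_apply_of_inHalf hL h4 U (mem_halfLinks.1 (Finset.mem_coe.1 he))).symm
  have hmp : MeasurePreserving (untwist' (G := G) (L := L) i j) (linkMeasure L G) (linkMeasure L G) :=
    (measurePreserving_configDiagSwap i j).comp
      ((measurePreserving_untwist hij).comp (measurePreserving_configDiagSwap i j))
  simp_rw [hpt]
  exact LatticeRP.integral_comp_eq_of_measurePreserving hmp (measurable_rpPhi ρ i j hρ β hF)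

/-- **The untwisted inequality**, every even `L ≥ 4`, `β ≥ 0`:
`0 ≤ ∫ g(U) conj g(ΘU) E(U) dU` for gauge-invariant closed-half observables. -/
theorem integral_rpPhi_nonneg_of_four_le (hL : Even L) (h4 : 4 ≤ L) {i j : Fin 2} (hij : i ≠ j)
    (hρ : Continuous ρ) {β : ℝ} (hβ : 0 ≤ β) {F : GaugeConfig 2 L G → ℂ} (hF : Measurable F)
    {CF : ℝ} (hFb : ∀ U, ‖F U‖ ≤ CF) (hFH : IsDiagonalHalfObservable i j F)
    (hFg : IsGaugeInvariant F) :
    0 ≤ ∫ U, rpPhi ρ i j β F U ∂(linkMeasure L G) := by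
  rw [← integral_twisted_eq_of_four_le ρ hL h4 hij hρ hβ hF hFH hFg]
  exact integral_twisted_nonneg ρ hL h4 hij hρ β hF hFb hFH

/-- **L3(ζ): diagonal reflection positivity HOLDS on the two-dimensional even torus `L ≥ 4` for
gauge-invariant observables** — in particular at `L = 4`, left open by L3(ε). Let `L ≥ 4` be
even, `G` a compact metrisable group, `ρ` a continuous finite-dimensional representation,
`β ≥ 0`, `i ≠ j`. Then for every bounded measurable GAUGE-INVARIANT observable `F` of the closed
diagonal half `{0 ≤ (y_i - y_j) mod L ≤ L/2}`, `0 ≤ ⟨(ΘF)‾ F⟩_{Λ,β}` (real and non-negative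
in `Complex.partialOrder`), `Θ` the diagonal swap. -/
theorem wilsonExpectation_swap_nonneg_of_isGaugeInvariant_of_four_le (hL : Even L) (h4 : 4 ≤ L)
    (hρ : Continuous ρ) {β : ℝ} (hβ : 0 ≤ β) {i j : Fin 2} (hij : i ≠ j)
    {F : GaugeConfig 2 L G → ℂ} (hF : Measurable F) (hFb : ∃ C : ℝ, ∀ U, ‖F U‖ ≤ C)
    (hFH : IsDiagonalHalfObservable i j F) (hFg : IsGaugeInvariant F) :
    0 ≤ wilsonExpectation ρ β fun U => (starRingEnd ℂ) (F (configDiagSwap i j U)) * F U := by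
  obtain ⟨CF, hFb⟩ := hFb
  have hdens : Measurable fun U : GaugeConfig 2 L G =>
      ENNReal.ofReal (Real.exp (-β * wilsonAction ρ U)) :=
    ENNReal.measurable_ofReal.comp ((WilsonRP.measurable_wilsonAction ρ hρ).const_mul (-β)).exp
  unfold wilsonExpectation wilsonMeasure
  rw [integral_smul_measure]
  unfold wilsonWeight
  rw [integral_withDensity_eq_integral_toReal_smul hdens (ae_of_all _ fun _ => ENNReal.ofReal_lt_top)]
  simp_rw [ENNReal.toReal_ofReal (Real.exp_nonneg _), Complex.real_smul]
  refine mul_nonneg (Complex.zero_le_real.2 ENNReal.toReal_nonneg) ?_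
  simp_rw [rpIntegrand_eq ρ hL h4 hij hρ β F]
  rw [integral_const_mul]
  exact mul_nonneg (Complex.zero_le_real.2 (Real.exp_pos _).le)
    (integral_rpPhi_nonneg_of_four_le ρ hL h4 hij hρ hβ hF hFb hFH hFg)

/-- **L3(ζ), packaged**: `GaugeInvariantDiagonalRP ρ β i j` holds on `(ℤ/L)²` for every even
`L ≥ 4` and every `β ≥ 0`. -/
theorem gaugeInvariantDiagonalRP_two_of_four_le (hL : Even L) (h4 : 4 ≤ L) (hρ : Continuous ρ)
    {β : ℝ} (hβ : 0 ≤ β) {i j : Fin 2} (hij : i ≠ j) :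
    GaugeInvariantDiagonalRP (d := 2) (L := L) ρ β i j :=
  fun _ hF hFb hFH hFg =>
    wilsonExpectation_swap_nonneg_of_isGaugeInvariant_of_four_le ρ hL h4 hρ hβ hij hF hFb hFH hFg

end MainFour

/-! ## `L = 2`: the gauge-invariant sector fails as well -/

section TwoByTwo

variable {L N : ℕ} {G : Type*} [Group G] [TopologicalSpace G] [IsTopologicalGroup G]
  [CompactSpace G] [MeasurableSpace G] [BorelSpace G] [SecondCountableTopology G]
  (ρ : G →* Matrix (Fin N) (Fin N) ℂ)

omit [CompactSpace G] [MeasurableSpace G] [BorelSpace G] [SecondCountableTopology G] in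
/-- `r_y` is continuous in the configuration. -/
theorem continuous_rr (hρ : Continuous ρ) (i j : Fin 2) (y : Site 2 L) :
    Continuous fun U : GaugeConfig 2 L G => rr ρ i j U y := by
  have h1 : Continuous fun U : GaugeConfig 2 L G => cT i j U y * (dT i j U y)⁻¹ := by
    unfold cT dT; fun_prop
  exact (Complex.continuous_re.comp hρ.matrix_trace).comp h1

/-- **The gauge-invariant `L = 2` witness.** On the `2 × 2` torus (every link in the closed half)
the two sites of the back layer `k = 1`, `e_i` and `e_j`, are exchanged by the swap, so
`F = r_{e_i} - r_{e_j}` (difference of the two plaquette terms based there) is bounded,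
measurable, GAUGE INVARIANT, swap-odd, and not identically zero as soon as `Re tr ρ` is not
constant; hence `⟨(ΘF)‾ F⟩_{Λ,β} = -⟨F²⟩_{Λ,β} < 0` at EVERY real `β`. -/
theorem exists_gaugeInvariant_wilsonExpectation_neg_two_two [T2Space G] (hρ : Continuous ρ)
    (hρN : ∃ g, ((ρ g).trace).re ≠ N) (β : ℝ) {i j : Fin 2} (hij : i ≠ j) :
    ∃ F : GaugeConfig 2 2 G → ℂ, Measurable F ∧ (∃ C : ℝ, ∀ U, ‖F U‖ ≤ C) ∧
      IsDiagonalHalfObservable i j F ∧ IsGaugeInvariant F ∧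
      (∀ U, F (configDiagSwap i j U) = -F U) ∧
      wilsonExpectation ρ β (fun U => (starRingEnd ℂ) (F (configDiagSwap i j U)) * F U) < 0 := by
  classical
  obtain ⟨g₀, hg₀⟩ := hρN
  have h10 : (1 : ZMod 2) ≠ 0 := by decide
  -- the two base points `x₀ = e_i`, `x₁ = θ x₀ = e_j`
  set x₀ : Site 2 2 := Pi.single i 1 with hx₀
  set x₁ : Site 2 2 := siteDiagSwap i j x₀ with hx₁
  have hx₀i : x₀ i = 1 := by simp [hx₀]
  have hx₀j : x₀ j = 0 := by simp [hx₀, Pi.single_eq_of_ne' hij]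
  have hx₁i : x₁ i = 0 := by simp [hx₁, siteDiagSwap, Equiv.swap_apply_left, hx₀j]
  have hθx₁ : siteDiagSwap i j x₁ = x₀ := siteDiagSwap_siteDiagSwap i j x₀
  -- the real observable
  set h : GaugeConfig 2 2 G → ℝ := fun U => rr ρ i j U x₀ - rr ρ i j U x₁ with hh
  have hh_cont : Continuous h := (continuous_rr ρ hρ i j x₀).sub (continuous_rr ρ hρ i j x₁)
  have hh_meas : Measurable h := hh_cont.measurable
  have hh_bound : ∀ U, |h U| ≤ 2 * N := fun U => by
    rw [hh]
    calc |rr ρ i j U x₀ - rr ρ i j U x₁| ≤ |rr ρ i j U x₀| + |rr ρ i j U x₁| := abs_sub _ _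
      _ ≤ N + N := add_le_add (abs_rr_le ρ hρ i j U x₀) (abs_rr_le ρ hρ i j U x₁)
      _ = 2 * N := by ring
  have hh_odd : ∀ U, h (configDiagSwap i j U) = -h U := fun U => by
    simp only [hh, rr_configDiagSwap ρ hρ, ← hx₁, hθx₁]
    ring
  refine ⟨fun U => (h U : ℂ), Complex.measurable_ofReal.comp hh_meas, ⟨2 * N, fun U => ?_⟩, ?_, ?_,
    fun U => ?_, ?_⟩
  · rw [Complex.norm_real, Real.norm_eq_abs]; exact hh_bound U
  · -- every link of the `2 × 2` torus lies in the closed half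
    intro U V hUV
    have hUV' : U = V := funext fun e => hUV e
      (by have := ZMod.val_lt (e.1 i - e.1 j); omega)
      (by have := ZMod.val_lt ((e.1.shift e.2) i - (e.1.shift e.2) j); omega)
    rw [hUV']
  · -- gauge invariant
    intro g U
    simp only [hh, rr_gaugeTransform]
  · show ((h (configDiagSwap i j U) : ℝ) : ℂ) = -((h U : ℝ) : ℂ)
    rw [hh_odd]; push_cast; ring
  · -- `⟨(ΘF)‾ F⟩ = -Z⁻¹ ∫ e^{-βS} h² < 0`
    have hint : (fun U => (starRingEnd ℂ) ((h (configDiagSwap i j U) : ℝ) : ℂ) * (h U : ℂ)) =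
        fun U => ((-(h U ^ 2) : ℝ) : ℂ) := by
      funext U
      rw [Complex.conj_ofReal, hh_odd]
      push_cast
      ring
    rw [hint, wilsonExpectation_ofReal_eq ρ hρ β, ← Complex.ofReal_zero, Complex.real_lt_real]
    -- a configuration on which `h ≠ 0`: `g₀` on the link `(x₀, i)`, `1` elsewhere
    set U₁ : GaugeConfig 2 2 G := Function.update (fun _ => (1 : G)) (x₀, i) g₀ with hU₁
    have hoff : ∀ e : Edge 2 2, e ≠ (x₀, i) → U₁ e = 1 := fun e he => by
      rw [hU₁, Function.update_of_ne he]
    have hsnd : ∀ z : Site 2 2, (z, j) ≠ (x₀, i) := fun z heq => hij (congrArg Prod.snd heq).symm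
    have hne1 : (x₀.shift j, i) ≠ (x₀, i) := fun heq => by
      have := congrFun (congrArg Prod.fst heq) j
      dsimp only at this
      rw [WilsonRP.shift_apply_self, hx₀j, zero_add] at this
      exact h10 this
    have hne2 : (x₁, i) ≠ (x₀, i) := fun heq => by
      have := congrFun (congrArg Prod.fst heq) i
      dsimp only at this
      rw [hx₁i, hx₀i] at this
      exact h10 this.symm
    have hne3 : (x₁.shift j, i) ≠ (x₀, i) := fun heq => by
      have := congrFun (congrArg Prod.fst heq) i
      dsimp only at this
      rw [WilsonRP.shift_apply_of_ne _ hij, hx₁i, hx₀i] at this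
      exact h10 this.symm
    have hr₀ : rr ρ i j U₁ x₀ = ((ρ g₀).trace).re := by
      rw [rr, cT, dT, hoff _ (hsnd _), hoff _ (hsnd _), hoff _ hne1, hU₁, Function.update_self]
      simp
    have hr₁ : rr ρ i j U₁ x₁ = N := by
      rw [rr, cT, dT, hoff _ hne2, hoff _ (hsnd _), hoff _ (hsnd _), hoff _ hne3]
      simp
    have hU₁h : h U₁ ≠ 0 := by
      simp only [hh, hr₀, hr₁]
      exact sub_ne_zero.2 hg₀
    set O : Set (GaugeConfig 2 2 G) := h ⁻¹' {0}ᶜ with hO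
    have hOo : IsOpen O := isOpen_compl_singleton.preimage hh_cont
    have hOne : O.Nonempty := ⟨U₁, hU₁h⟩
    have hOh : ∀ U ∈ O, h U ≠ 0 := fun U hU => hU
    have hpos := integral_exp_mul_sq_pos (d := 2) (L := 2) ρ hρ β hh_meas hh_bound hOo hOne hOh
    have hrw : (fun U : GaugeConfig 2 2 G => Real.exp (-β * wilsonAction ρ U) * -(h U ^ 2)) =
        fun U => -(Real.exp (-β * wilsonAction ρ U) * h U ^ 2) := funext fun U => by ring
    rw [hrw, integral_neg, mul_neg]
    linarith

/-- **`L = 2`: gauge invariance does not rescue diagonal RP on the `2 × 2` torus** — at every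
real `β`, for every compact metrisable `G` and every continuous `ρ` with non-constant character
(contrast `gaugeInvariantDiagonalRP_two_of_four_le`: every even `L ≥ 4`, `β ≥ 0`, HOLDS). -/
theorem not_gaugeInvariantDiagonalRP_two_two [T2Space G] (hρ : Continuous ρ)
    (hρN : ∃ g, ((ρ g).trace).re ≠ N) (β : ℝ) {i j : Fin 2} (hij : i ≠ j) :
    ¬ GaugeInvariantDiagonalRP (d := 2) (L := 2) ρ β i j := by
  intro hRP
  obtain ⟨F, hF, hFb, hFH, hFg, -, hneg⟩ :=
    exists_gaugeInvariant_wilsonExpectation_neg_two_two ρ hρ hρN β hij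
  exact lt_irrefl _ (lt_of_le_of_lt (hRP F hF hFb hFH hFg) hneg)

/-- **The complete two-dimensional classification (gauge-invariant sector).** On the even torus
`(ℤ/L)²`, `L ≥ 2`, with `β ≥ 0`, `G` compact metrisable and `ρ` continuous with non-constant
character: closed-half diagonal reflection positivity for gauge-invariant observables holds
if and only if `L ≥ 4`. -/
theorem gaugeInvariantDiagonalRP_two_iff [NeZero L] [T2Space G] (hL : Even L) (h2 : 2 ≤ L) (hρ : Continuous ρ) (hρN : ∃ g, ((ρ g).trace).re ≠ N) {β : ℝ}
    (hβ : 0 ≤ β) {i j : Fin 2} (hij : i ≠ j) :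
    GaugeInvariantDiagonalRP (d := 2) (L := L) ρ β i j ↔ 4 ≤ L := by
  refine ⟨fun h => ?_, fun h4 => gaugeInvariantDiagonalRP_two_of_four_le ρ hL h4 hρ hβ hij⟩
  by_contra h4
  obtain ⟨r, hr⟩ := hL
  obtain rfl : L = 2 := by omega
  exact not_gaugeInvariantDiagonalRP_two_two ρ hρ hρN β hij h

end TwoByTwo

end DiagRPTwo

end

end Summit.QuantumFields.GaugeBoot
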